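import Literature.Computability.AlgebraicComplexity.SupportSymmetrisation
import HarnessLib

/-!
# Support symmetrisation of straight-line programs: symmetry, size and semantics

Topic `Computability/AlgebraicComplexity`, namespace
`Literature.Computability.AlgebraicComplexity.SupportSymm`. Continuation of
`SupportSymmetrisation.lean` (the circuit `SupportedProgram.circuit` of a supported
straight-line program `P` on the `n × n` variable matrix, with one copy `[i, κ]` of program gate
`i` per injection `κ : supp i ↪ Fin n`):

* SYMMETRY (`isAutomorphismExtending_perm`, `isSymmetric_circuit`): `[i, κ] ↦ [i, σ ∘ κ]` is a
  circuit automorphism extending `σ` (Dawar–Wilsenach 2025, Def. 3.6) when the output gate has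
  empty support, so the circuit is `Sym(Fin n)`-symmetric (Def. 3.7) — compatibility of partial
  injections is translation equivariant;
* SIZE (`card_node_eq`, `card_node_le`): `n² + |consts| + Σᵢ n^{(|Kᵢ|)} (1 + 2 · arity i)`, at
  most `3 (W + 1)(2A + 1)(n + 1)^(k + 2)` for `W` gates of fan-in `≤ A` and supports of size `≤ k`;
* SEMANTICS (`eval_main`, `eval_output`): over a field of characteristic `0`, the copy `[i, κ]`
  computes `ren ρ vᵢ` for every permutation `ρ` extending `κ`, by strong induction on `i` —
  product gates (`eval_main_of_prod`): the only compatible copy of an operand supported inside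
  `Kᵢ` is the restriction of `κ`; sum gates (`eval_main_of_sum`): the AVERAGING IDENTITY
  `(n-|Kᵢ|)! · ren ρ vᵢ = Σ_{θ ⊇ κ} ren θ vᵢ = Σ_t a_t Σ_{θ ⊇ κ} ren θ u_t
   = Σ_t a_t (n-|Kᵢ ∪ supp u_t|)! Σ_{μ compatible} [copy of u_t along μ]`
  (coset decomposition `sum_extSet_eq_smul_sum_compatSet`), divided by `(n-|Kᵢ|)! ≠ 0`;
* the PACKAGED STATEMENT for tree `ArithCircuit`s (`exists_symmetric_circuit_of_supports`).

Sources as in the companion file: Dawar–Pago–Seppelt 2025, §5 (one gate per tuple of support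
values, converse direction of the support theorem); Anderson–Dawar 2017, §4; Dawar–Wilsenach
2025, Defs. 2.2, 3.6, 3.7. Everything is proved; no named facts.
-/

noncomputable section

namespace Literature.Computability.AlgebraicComplexity

open MvPolynomial

universe u

namespace SupportSymm

variable {n : ℕ}

namespace SupportedProgram

variable {F : Type u} [Field F] {P : SupportedProgram F n}

/-- `perm σ` translates copies of operands. [folklore] -/
theorem perm_copy (σ : Equiv.Perm (Fin n)) (u : ArithCircuit.Operand F (Fin n × Fin n))
    (μ : ↥(osupp P.supp u) ↪ Fin n) :
    P.perm σ (copy u μ) = copy u (μ.trans σ.toEmbedding) := by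
  cases u with
  | var pq => rfl
  | const c => simp only [copy]; split_ifs <;> rfl
  | gate j => simp only [copy]; split_ifs <;> rfl

/-- Wires go to wires under `perm σ`. [cite: DawarPagoSeppelt2025, §5] -/
theorem children_perm (σ : Equiv.Perm (Fin n)) (g : Node P) :
    P.children (P.perm σ g) = (P.children g).map (P.perm σ).toEmbedding := by
  cases g with
  | var p q => simp [children]
  | cst c => simp [children]
  | main i κ =>
    rw [perm_main, children, children, Finset.map_eq_image, Finset.image_image]
    rfl
  | argM i κ t =>
    rw [perm_argM, children, children, Finset.map_insert, Finset.map_singleton]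
    rfl
  | argS i κ t =>
    rw [perm_argS, children, children, Finset.map_eq_image, Finset.image_image,
      ← compatSet_image_trans, Finset.image_image]
    congr 1
    funext μ
    exact (perm_copy σ _ μ).symm

/-- Labels transform under `σ` (variables diagonally, everything else fixed).
[cite: DawarPagoSeppelt2025, §5] -/
theorem label_perm (σ : Equiv.Perm (Fin n)) (g : Node P) :
    P.label (P.perm σ g) = σ • P.label g := by
  cases g with
  | var p q => rfl
  | cst c => rfl
  | main i κ =>
    change mainLabel (P.gate i) = σ • mainLabel (P.gate i)
    cases P.gate i <;> rfl
  | argM i κ t => rfl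
  | argS i κ t => rfl

/-- **Symmetry.** If the output gate has empty support, `perm σ` is a circuit automorphism
extending `σ`, for every `σ ∈ Sym(Fin n)`. [cite: DawarPagoSeppelt2025, §5] -/
theorem isAutomorphismExtending_perm (hout : P.supp P.out = ∅) (σ : Equiv.Perm (Fin n)) :
    P.circuit.IsAutomorphismExtending σ (P.perm σ) := by
  refine ⟨children_perm σ, label_perm σ, fun _ => ?_⟩
  change Node.main ⟨P.out, P.out_lt⟩ (inclEmb (P.supp P.out)) =
    Node.main ⟨P.out, P.out_lt⟩ ((inclEmb (P.supp P.out)).trans σ.toEmbedding)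
  congr 1
  refine Function.Embedding.ext fun x => ?_
  have hx := x.2
  simp only [hout] at hx
  exact absurd hx (Finset.notMem_empty _)

/-- **The support symmetrisation is `Sym(Fin n)`-symmetric** (output of empty support).
[cite: DawarPagoSeppelt2025, §5] -/
theorem isSymmetric_circuit (hout : P.supp P.out = ∅) :
    P.circuit.IsSymmetric (Equiv.Perm (Fin n)) :=
  fun σ => ⟨P.perm σ, isAutomorphismExtending_perm hout σ⟩

/-! ### Size -/

variable (P)

omit [Field F] in
/-- The number of copies of gate `i`: injections `supp i ↪ Fin n`, a falling factorial.
[folklore] -/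
theorem card_copies (i : ℕ) :
    Fintype.card (↥(P.supp i) ↪ Fin n) = n.descFactorial (P.supp i).card := by
  rw [Fintype.card_embedding_eq, Fintype.card_coe, Fintype.card_fin]

/-- The exact gate count. [folklore] -/
theorem card_node_eq : Fintype.card (Node P) = n * n + P.consts.card +
    ∑ i : Fin P.gates.length, n.descFactorial (P.supp i).card +
    ∑ i : Fin P.gates.length, n.descFactorial (P.supp i).card * arity (P.gate i) +
    ∑ i : Fin P.gates.length, n.descFactorial (P.supp i).card * arity (P.gate i) := by
  rw [Fintype.card_congr (Node.equivSum P)]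
  simp only [Fintype.card_sum, Fintype.card_prod, Fintype.card_sigma, Fintype.card_fin,
    Fintype.card_coe, card_copies]
  ring

/-- **Size.** With supports of size `≤ k` and fan-in `≤ A`, the symmetrisation has at most
`3 (W + 1)(2A + 1)(n + 1)^(k + 2)` gates, `W` the number of program gates. [folklore] -/
theorem card_node_le {k A : ℕ} (hk : ∀ i, (P.supp i).card ≤ k)
    (hA : ∀ g ∈ P.gates, g.fanIn ≤ A) :
    Fintype.card (Node P) ≤ 3 * (P.gates.length + 1) * (2 * A + 1) * (n + 1) ^ (k + 2) := by
  set W := P.gates.length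
  set X := (n + 1) ^ (k + 2)
  have hX1 : 1 ≤ X := Nat.one_le_pow _ _ (Nat.succ_pos n)
  have hd : ∀ i : ℕ, n.descFactorial (P.supp i).card ≤ (n + 1) ^ k := fun i =>
    calc n.descFactorial (P.supp i).card ≤ n ^ (P.supp i).card := Nat.descFactorial_le_pow _ _
      _ ≤ (n + 1) ^ (P.supp i).card := Nat.pow_le_pow_left (Nat.le_succ n) _
      _ ≤ (n + 1) ^ k := Nat.pow_le_pow_right (Nat.succ_pos n) (hk i)
  have har : ∀ i : Fin W, arity (P.gate i) ≤ A := fun i => by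
    rw [arity_eq_length_args]
    exact hA _ (List.getElem_mem i.2)
  have hkX : (n + 1) ^ k ≤ X := Nat.pow_le_pow_right (Nat.succ_pos n) (Nat.le_add_right k 2)
  have h1 : n * n + P.consts.card ≤ X + (1 + 2 * (W * A)) := by
    have hc := P.card_consts_le
    have hs : ∑ i : Fin W, 2 * arity (P.gate i) ≤ W * (2 * A) := by
      have := Finset.sum_le_card_nsmul (Finset.univ : Finset (Fin W))
        (fun i => 2 * arity (P.gate i)) (2 * A) (fun i _ => Nat.mul_le_mul_left 2 (har i))
      simpa using this
    have hn : n * n ≤ X :=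
      calc n * n ≤ (n + 1) ^ 2 := by nlinarith
        _ ≤ X := Nat.pow_le_pow_right (Nat.succ_pos n) (Nat.le_add_left 2 k)
    nlinarith
  have h2 : ∑ i : Fin W, n.descFactorial (P.supp i).card ≤ W * (n + 1) ^ k := by
    have := Finset.sum_le_card_nsmul (Finset.univ : Finset (Fin W))
      (fun i => n.descFactorial (P.supp i).card) ((n + 1) ^ k) (fun i _ => hd i)
    simpa using this
  have h3 : ∑ i : Fin W, n.descFactorial (P.supp i).card * arity (P.gate i) ≤
      W * ((n + 1) ^ k * A) := by
    have := Finset.sum_le_card_nsmul (Finset.univ : Finset (Fin W))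
      (fun i => n.descFactorial (P.supp i).card * arity (P.gate i)) ((n + 1) ^ k * A)
      (fun i _ => Nat.mul_le_mul (hd i) (har i))
    simpa using this
  rw [card_node_eq]
  calc n * n + P.consts.card + ∑ i : Fin W, n.descFactorial (P.supp i).card +
      ∑ i : Fin W, n.descFactorial (P.supp i).card * arity (P.gate i) +
      ∑ i : Fin W, n.descFactorial (P.supp i).card * arity (P.gate i)
      ≤ X + (1 + 2 * (W * A)) + W * (n + 1) ^ k + W * ((n + 1) ^ k * A) + W * ((n + 1) ^ k * A) :=
        Nat.add_le_add (Nat.add_le_add (Nat.add_le_add h1 h2) h3) h3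
    _ = X + (1 + 2 * (W * A)) + W * (n + 1) ^ k * (2 * A + 1) := by ring
    _ ≤ (W + 1) * (2 * A + 1) * X + (W + 1) * (2 * A + 1) * X + (W + 1) * (2 * A + 1) * X := by
        refine Nat.add_le_add (Nat.add_le_add ?_ ?_) ?_
        · calc X = 1 * 1 * X := by ring
            _ ≤ (W + 1) * (2 * A + 1) * X :=
              Nat.mul_le_mul_right _ (Nat.mul_le_mul (Nat.le_add_left 1 W) (by omega))
        · calc 1 + 2 * (W * A) ≤ (W + 1) * (2 * A + 1) := by nlinarith
            _ = (W + 1) * (2 * A + 1) * 1 := (mul_one _).symm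
            _ ≤ (W + 1) * (2 * A + 1) * X := Nat.mul_le_mul_left _ hX1
        · calc W * (n + 1) ^ k * (2 * A + 1) = W * (2 * A + 1) * (n + 1) ^ k := by ring
            _ ≤ (W + 1) * (2 * A + 1) * X :=
              Nat.mul_le_mul (Nat.mul_le_mul_right _ (Nat.le_succ W)) hkX
    _ = 3 * (W + 1) * (2 * A + 1) * X := by ring

/-! ### Semantics -/

variable {P}

omit [Field F] in
/-- `RefsBelow` is monotone in the bound. [folklore] -/
theorem refsBelow_mono {u : ArithCircuit.Operand F (Fin n × Fin n)} {i m : ℕ} (h : u.RefsBelow i)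
    (him : i ≤ m) : u.RefsBelow m := by
  cases u with
  | var _ => trivial
  | const _ => trivial
  | gate j => exact lt_of_lt_of_le (show j < i from h) him

/-- Constant gates compute their constant. [folklore] -/
theorem eval_cst (c : ↥P.consts) : P.circuit.eval (.cst c) = C c.1 :=
  P.circuit.eval_of_label_const (show P.circuit.label (.cst c) = .const c.1 from rfl)

/-- Variable gates compute their variable. [folklore] -/
theorem eval_var (p q : Fin n) : P.circuit.eval (.var p q) = X (p, q) :=
  P.circuit.eval_of_label_var (show P.circuit.label (.var p q) = .var (p, q) from rfl)

/-- The label of the copies of a sum gate. [folklore] -/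
theorem label_main_of_sum {i : Fin P.gates.length} (hs : (P.gate i).isProd = false)
    (κ : ↥(P.supp i) ↪ Fin n) : P.circuit.label (.main i κ) = .add := by
  change mainLabel (P.gate i) = .add
  revert hs
  generalize P.gate i = g
  cases g with
  | sum _ => exact fun _ => rfl
  | prod _ => exact fun h => by simp [ArithCircuit.Gate.isProd] at h

/-- The label of the copies of a product gate. [folklore] -/
theorem label_main_of_prod {i : Fin P.gates.length} (hs : (P.gate i).isProd = true)
    (κ : ↥(P.supp i) ↪ Fin n) : P.circuit.label (.main i κ) = .mul := by
  change mainLabel (P.gate i) = .mul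
  revert hs
  generalize P.gate i = g
  cases g with
  | sum _ => exact fun h => by simp [ArithCircuit.Gate.isProd] at h
  | prod _ => exact fun _ => rfl

/-- `argM i κ` is injective in the operand position. [folklore] -/
theorem argM_injective (i : Fin P.gates.length) (κ : ↥(P.supp i) ↪ Fin n) :
    Function.Injective (fun t : Fin (arity (P.gate i)) => (Node.argM i κ t : Node P)) := by
  intro t t' h
  simpa using h

/-- A sum-gate copy is the sum of its gadgets. [folklore] -/
theorem eval_main_of_sum_eq {i : Fin P.gates.length} (hs : (P.gate i).isProd = false)
    (κ : ↥(P.supp i) ↪ Fin n) :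
    P.circuit.eval (.main i κ) =
      ∑ t : Fin (arity (P.gate i)), P.circuit.eval (.argM i κ t) := by
  rw [P.circuit.eval_of_label_add (label_main_of_sum hs κ)]
  change ∑ g ∈ Finset.univ.image (fun t => Node.argM i κ t), P.circuit.eval g = _
  rw [Finset.sum_image fun t _ t' _ h => argM_injective i κ h]

/-- A product-gate copy is the product of its gadgets. [folklore] -/
theorem eval_main_of_prod_eq {i : Fin P.gates.length} (hs : (P.gate i).isProd = true)
    (κ : ↥(P.supp i) ↪ Fin n) :
    P.circuit.eval (.main i κ) =
      ∏ t : Fin (arity (P.gate i)), P.circuit.eval (.argM i κ t) := by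
  rw [P.circuit.eval_of_label_mul (label_main_of_prod hs κ)]
  change ∏ g ∈ Finset.univ.image (fun t => Node.argM i κ t), P.circuit.eval g = _
  rw [Finset.prod_image fun t _ t' _ h => argM_injective i κ h]

/-- The multiplication gadget: constant times the addition gadget. [folklore] -/
theorem eval_argM (i : Fin P.gates.length) (κ : ↥(P.supp i) ↪ Fin n)
    (t : Fin (arity (P.gate i))) :
    P.circuit.eval (.argM i κ t) = C (P.coef i t) * P.circuit.eval (.argS i κ t) := by
  rw [P.circuit.eval_of_label_mul (show P.circuit.label (.argM i κ t) = .mul from rfl)]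
  change ∏ g ∈ ({Node.cst ⟨P.coef i t, P.coef_mem_consts i t⟩, Node.argS i κ t} :
    Finset (Node P)), P.circuit.eval g = _
  rw [Finset.prod_pair (by simp), eval_cst]

/-- Copies of a genuine operand are distinct for distinct partial injections. [folklore] -/
theorem copy_injective (u : ArithCircuit.Operand F (Fin n × Fin n))
    (hu : u.RefsBelow P.gates.length) :
    Function.Injective (copy (P := P) u) := by
  intro μ μ' h
  cases u with
  | var pq =>
    simp only [copy, Node.var.injEq] at h
    refine Function.Embedding.ext fun x => ?_
    have hx := x.2
    simp only [osupp, Finset.mem_insert, Finset.mem_singleton] at hx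
    rcases hx with hx | hx
    · have : x = ⟨pq.1, by simp [osupp]⟩ := Subtype.ext hx
      rw [this]; exact h.1
    · have : x = ⟨pq.2, by simp [osupp]⟩ := Subtype.ext hx
      rw [this]; exact h.2
  | const c =>
    refine Function.Embedding.ext fun x => ?_
    have hx : (x : Fin n) ∈ (∅ : Finset (Fin n)) := x.2
    exact absurd hx (Finset.notMem_empty _)
  | gate j =>
    have hj : j < P.gates.length := hu
    simp only [copy, dif_pos hj, Node.main.injEq, heq_eq_eq, true_and] at h
    exact h

/-- The addition gadget: the sum of all compatible copies of the operand. [folklore] -/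
theorem eval_argS (i : Fin P.gates.length) (κ : ↥(P.supp i) ↪ Fin n)
    (t : Fin (arity (P.gate i))) :
    P.circuit.eval (.argS i κ t) = ∑ μ ∈ compatSet (P.supp i) κ (P.osuppAt i t),
      P.circuit.eval (copy (operand (P.gate i) t) μ) := by
  rw [P.circuit.eval_of_label_add (show P.circuit.label (.argS i κ t) = .add from rfl)]
  change ∑ g ∈ (compatSet (P.supp i) κ (P.osuppAt i t)).image (copy (operand (P.gate i) t)),
    P.circuit.eval g = _
  rw [Finset.sum_image fun μ _ μ' _ h =>
    copy_injective _ (refsBelow_mono (P.refsBelow_operand i t) i.2.le) h]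

/-- **Copies of operands.** Given the induction hypothesis for the gates below `i`, the copy of
an operand `u` of gate `i` along `μ` computes `ren θ (value of u)` for every permutation `θ`
extending `μ`. [cite: DawarPagoSeppelt2025, §5] -/
theorem eval_copy {i : ℕ} (u : ArithCircuit.Operand F (Fin n × Fin n)) (hr : u.RefsBelow i)
    (hi : i ≤ P.gates.length) (hc : ∀ c, u = .const c → c ∈ P.consts)
    (ih : ∀ j : Fin P.gates.length, (j : ℕ) < i → ∀ (κ : ↥(P.supp j) ↪ Fin n)
      (ρ : Equiv.Perm (Fin n)), Extends (P.supp j) κ ρ →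
      P.circuit.eval (.main j κ) = rename (diag ρ) (P.val j))
    (μ : ↥(osupp P.supp u) ↪ Fin n) (θ : Equiv.Perm (Fin n))
    (hθ : ∀ x : ↥(osupp P.supp u), θ x = μ x) :
    P.circuit.eval (copy u μ) = rename (diag θ) (u.eval P.vals) := by
  cases u with
  | var pq =>
    have h1 := hθ ⟨pq.1, by simp [osupp]⟩
    have h2 := hθ ⟨pq.2, by simp [osupp]⟩
    simp only at h1 h2
    simp only [copy, eval_var, ArithCircuit.Operand.eval, rename_X, diag_apply]
    rw [h1, h2]
  | const c =>
    simp only [copy, dif_pos (hc c rfl), eval_cst, ArithCircuit.Operand.eval, rename_C]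
  | gate j =>
    have hji : j < i := hr
    have hj : j < P.gates.length := lt_of_lt_of_le hji hi
    simp only [copy, dif_pos hj, ArithCircuit.Operand.eval_gate]
    exact ih ⟨j, hj⟩ hji μ θ hθ

/-- **Invariance of operand values**: the value of an operand is invariant under the pointwise
stabiliser of its support. [cite: DawarPagoSeppelt2025, §5] -/
theorem rename_diag_operand_eval
    (hinv : ∀ (j : ℕ) (σ : Equiv.Perm (Fin n)), j < P.gates.length →
      (∀ x ∈ P.supp j, σ x = x) → rename (diag σ) (P.val j) = P.val j)
    (u : ArithCircuit.Operand F (Fin n × Fin n)) (hu : u.RefsBelow P.gates.length)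
    (σ : Equiv.Perm (Fin n))
    (hσ : ∀ x ∈ osupp P.supp u, σ x = x) :
    rename (diag σ) (u.eval P.vals) = u.eval P.vals := by
  cases u with
  | var pq =>
    have h1 := hσ pq.1 (by simp [osupp])
    have h2 := hσ pq.2 (by simp [osupp])
    simp only [ArithCircuit.Operand.eval, rename_X, diag_apply, h1, h2, Prod.mk.eta]
  | const c => simp only [ArithCircuit.Operand.eval, rename_C]
  | gate j => exact hinv j σ hu hσ

section CharZero

variable [CharZero F]

/-- **Sum gates: the averaging identity.** Given the induction hypothesis below `i`, the copy
`[i, κ]` of a SUM gate computes `ren ρ vᵢ` for every `ρ` extending `κ`: averaging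
`ren θ vᵢ` over the coset of all extensions `θ` of `κ` and decomposing the coset along the
restrictions `θ|supp(u_t)` (each compatible partial injection is hit `(n - |Kᵢ ∪ supp u_t|)!`
times) yields `(n - |Kᵢ|)! · [i, κ] = (n - |Kᵢ|)! · ren ρ vᵢ`, and `(n - |Kᵢ|)! ≠ 0`
in characteristic `0`.
[cite: DawarPagoSeppelt2025, §5] -/
theorem eval_main_of_sum
    (hinv : ∀ (j : ℕ) (σ : Equiv.Perm (Fin n)), j < P.gates.length →
      (∀ x ∈ P.supp j, σ x = x) → rename (diag σ) (P.val j) = P.val j)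
    (i : Fin P.gates.length) (hs : (P.gate i).isProd = false)
    (ih : ∀ j : Fin P.gates.length, (j : ℕ) < i → ∀ (κ : ↥(P.supp j) ↪ Fin n)
      (ρ : Equiv.Perm (Fin n)), Extends (P.supp j) κ ρ →
      P.circuit.eval (.main j κ) = rename (diag ρ) (P.val j))
    (κ : ↥(P.supp i) ↪ Fin n) (ρ : Equiv.Perm (Fin n)) (hρ : Extends (P.supp i) κ ρ) :
    P.circuit.eval (.main i κ) = rename (diag ρ) (P.val i) := by
  have hN : ((n - (P.supp i).card).factorial : F) ≠ 0 :=
    Nat.cast_ne_zero.2 (Nat.factorial_ne_zero _)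
  -- circuit side
  have hC : P.circuit.eval (.main i κ) = ∑ t : Fin (arity (P.gate i)), C (P.coef i t) *
      ∑ μ ∈ compatSet (P.supp i) κ (P.osuppAt i t),
        P.circuit.eval (copy (operand (P.gate i) t) μ) := by
    rw [eval_main_of_sum_eq hs]
    simp only [eval_argM, eval_argS]
  -- program side
  have hV : P.val i = ∑ t : Fin (arity (P.gate i)),
      coeff (P.gate i) t • (operand (P.gate i) t).eval P.vals := by
    rw [val_eq_eval, gateEval_eq_sum _ _ hs]
  -- (a) all extensions of κ rename vᵢ alike
  have ha : ∀ θ ∈ extSet (P.supp i) κ,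
      rename (diag θ) (P.val i) = rename (diag ρ) (P.val i) := fun θ hθ =>
    rename_diag_eq_of_agree (P.supp i) (fun σ hσ => hinv i σ i.2 hσ) fun x hx => by
      rw [mem_extSet.1 hθ ⟨x, hx⟩, hρ ⟨x, hx⟩]
  -- (b) the coset average
  have hb : ((n - (P.supp i).card).factorial : F) • rename (diag ρ) (P.val i) =
      ∑ θ ∈ extSet (P.supp i) κ, rename (diag θ) (P.val i) := by
    rw [Finset.sum_congr rfl ha, Finset.sum_const, card_extSet, Nat.cast_smul_eq_nsmul]
  -- (c) expand vᵢ inside the average and swap sums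
  have hc : ∑ θ ∈ extSet (P.supp i) κ, rename (diag θ) (P.val i) =
      ∑ t : Fin (arity (P.gate i)), coeff (P.gate i) t • ∑ θ ∈ extSet (P.supp i) κ,
        rename (diag θ) ((operand (P.gate i) t).eval P.vals) := by
    simp_rw [hV, map_sum, map_smul]
    rw [Finset.sum_comm]
    simp_rw [Finset.smul_sum]
  -- (d) fibre decomposition of the inner sums
  have hd : ∀ t : Fin (arity (P.gate i)),
      ∑ θ ∈ extSet (P.supp i) κ, rename (diag θ) ((operand (P.gate i) t).eval P.vals) =
        (n - (P.supp i ∪ P.osuppAt i t).card).factorial •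
          ∑ μ ∈ compatSet (P.supp i) κ (P.osuppAt i t),
            P.circuit.eval (copy (operand (P.gate i) t) μ) := by
    intro t
    rw [← sum_extSet_eq_smul_sum_compatSet (P.supp i) κ (P.osuppAt i t)
      (fun μ => P.circuit.eval (copy (operand (P.gate i) t) μ))]
    refine Finset.sum_congr rfl fun θ _ => ?_
    exact (eval_copy _ (P.refsBelow_operand i t) i.2.le
      (fun c hc => P.mem_consts_of_operand_eq i t hc) ih (resEmb _ θ) θ (fun x => rfl)).symm
  -- (e) combine and cancel `(n - |Kᵢ|)!`
  apply smul_right_injective (MvPolynomial (Fin n × Fin n) F) hN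
  change ((n - (P.supp i).card).factorial : F) • P.circuit.eval (.main i κ) =
    ((n - (P.supp i).card).factorial : F) • rename (diag ρ) (P.val i)
  rw [hb, hc, hC, Finset.smul_sum]
  refine Finset.sum_congr rfl fun t _ => ?_
  rw [hd t, ← Nat.cast_smul_eq_nsmul F, smul_smul, smul_eq_C_mul, smul_eq_C_mul, ← mul_assoc,
    ← C_mul]
  congr 2
  simp only [coef, avgConst]
  rw [mul_comm ((n - (P.supp i).card).factorial : F), mul_assoc, div_mul_cancel₀ _ hN]

/-- **Product gates.** Given the induction hypothesis below `i`, the copy `[i, κ]` of a PRODUCT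
gate computes `ren ρ vᵢ` (`ρ ⊇ κ`): every operand is supported inside `Kᵢ`, so its only
compatible copy is the restriction of `κ`, and the gadget constant is `1`.
[cite: DawarPagoSeppelt2025, §5] -/
theorem eval_main_of_prod
    (hprod : ∀ i : Fin P.gates.length, (P.gate i).isProd = true →
      ∀ t : Fin (arity (P.gate i)), P.osuppAt i t ⊆ P.supp i)
    (i : Fin P.gates.length) (hs : (P.gate i).isProd = true)
    (ih : ∀ j : Fin P.gates.length, (j : ℕ) < i → ∀ (κ : ↥(P.supp j) ↪ Fin n)
      (ρ : Equiv.Perm (Fin n)), Extends (P.supp j) κ ρ →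
      P.circuit.eval (.main j κ) = rename (diag ρ) (P.val j))
    (κ : ↥(P.supp i) ↪ Fin n) (ρ : Equiv.Perm (Fin n)) (hρ : Extends (P.supp i) κ ρ) :
    P.circuit.eval (.main i κ) = rename (diag ρ) (P.val i) := by
  have hN : ((n - (P.supp i).card).factorial : F) ≠ 0 :=
    Nat.cast_ne_zero.2 (Nat.factorial_ne_zero _)
  rw [eval_main_of_prod_eq hs, val_eq_eval, gateEval_eq_prod _ _ hs,
    map_prod]
  refine Finset.prod_congr rfl fun t _ => ?_
  have hsub : P.osuppAt i t ⊆ P.supp i := hprod i hs t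
  rw [eval_argM, eval_argS, coef, coeff_of_isProd _ hs, one_mul, avgConst,
    Finset.union_eq_left.2 hsub, div_self hN, C_1, one_mul,
    compatSet_eq_singleton_of_subset κ hsub, Finset.sum_singleton]
  exact eval_copy _ (P.refsBelow_operand i t) i.2.le (fun c hc => P.mem_consts_of_operand_eq i t hc)
    ih (restrEmb κ hsub) ρ fun x => hρ ⟨x, hsub x.2⟩

/-- **Semantics of the copies.** The copy `[i, κ]` computes `ren ρ vᵢ` for every permutation
`ρ` extending `κ` (well defined by invariance). [cite: DawarPagoSeppelt2025, §5] -/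
theorem eval_main
    (hinv : ∀ (j : ℕ) (σ : Equiv.Perm (Fin n)), j < P.gates.length →
      (∀ x ∈ P.supp j, σ x = x) → rename (diag σ) (P.val j) = P.val j)
    (hprod : ∀ i : Fin P.gates.length, (P.gate i).isProd = true →
      ∀ t : Fin (arity (P.gate i)), P.osuppAt i t ⊆ P.supp i)
    (i : Fin P.gates.length) (κ : ↥(P.supp i) ↪ Fin n) (ρ : Equiv.Perm (Fin n))
    (hρ : Extends (P.supp i) κ ρ) :
    P.circuit.eval (.main i κ) = rename (diag ρ) (P.val i) := by
  suffices H : ∀ (m : ℕ) (i : Fin P.gates.length), (i : ℕ) = m →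
      ∀ (κ : ↥(P.supp i) ↪ Fin n) (ρ : Equiv.Perm (Fin n)), Extends (P.supp i) κ ρ →
      P.circuit.eval (.main i κ) = rename (diag ρ) (P.val i) from H i i rfl κ ρ hρ
  intro m
  induction m using Nat.strong_induction_on with
  | _ m IH =>
    intro i hi κ ρ hρ
    have ih : ∀ j : Fin P.gates.length, (j : ℕ) < i → ∀ (κ : ↥(P.supp j) ↪ Fin n)
        (ρ : Equiv.Perm (Fin n)), Extends (P.supp j) κ ρ →
        P.circuit.eval (.main j κ) = rename (diag ρ) (P.val j) :=
      fun j hj κ' ρ' h' => IH j (hi ▸ hj) j rfl κ' ρ' h'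
    cases hs : (P.gate i).isProd
    · exact eval_main_of_sum hinv i hs ih κ ρ hρ
    · exact eval_main_of_prod hprod i hs ih κ ρ hρ

/-- **The symmetrisation computes the program's output.** [cite: DawarPagoSeppelt2025, §5] -/
theorem eval_output
    (hinv : ∀ (j : ℕ) (σ : Equiv.Perm (Fin n)), j < P.gates.length →
      (∀ x ∈ P.supp j, σ x = x) → rename (diag σ) (P.val j) = P.val j)
    (hprod : ∀ i : Fin P.gates.length, (P.gate i).isProd = true →
      ∀ t : Fin (arity (P.gate i)), P.osuppAt i t ⊆ P.supp i) :
    P.circuit.eval (P.circuit.output ()) = P.val P.out := by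
  change P.circuit.eval (.main ⟨P.out, P.out_lt⟩ (inclEmb (P.supp P.out))) = _
  rw [eval_main hinv hprod _ _ 1 (fun y => rfl), rename_diag_one]

end CharZero

end SupportedProgram

/-! ### The packaged statement for tree `ArithCircuit`s -/

open SupportedProgram in
/-- **Support symmetrisation (coset-block symmetrisation).** A well-formed straight-line program
`P` over a field of characteristic `0` on the `n × n` variable matrix, with non-nullary gates of
fan-in `≤ A`, annotated with supports `K i` of size `≤ k` such that product gates take only
operands supported inside `K i`, the value of gate `i` is invariant under the pointwise
stabiliser of `K i` (diagonal action of `Sym(Fin n)`), and the output is a gate of empty support,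
is computed by a `Sym(Fin n)`-symmetric Dawar–Wilsenach circuit with at most
`3 (size + 1)(2A + 1)(n + 1)^(k + 2)` gates (cf. Dawar–Pago–Seppelt 2025, §5: one copy of each
gate per tuple of values of its support; Anderson–Dawar supports).
[cite: DawarPagoSeppelt2025, §5] -/
theorem exists_symmetric_circuit_of_supports {F : Type u} [Field F] [CharZero F] (k A : ℕ)
    (P : ArithCircuit F (Fin n × Fin n)) (K : ℕ → Finset (Fin n))
    (hne : ∀ g ∈ P.gates, g.args ≠ []) (hA : ∀ g ∈ P.gates, g.fanIn ≤ A)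
    (hwf : P.WellFormed) (hk : ∀ i, (K i).card ≤ k)
    (hprod : ∀ (i : ℕ) (us : List (ArithCircuit.Operand F (Fin n × Fin n))),
      P.gates[i]? = some (.prod us) → ∀ u ∈ us, osupp K u ⊆ K i)
    (hinv : ∀ (i : ℕ) (σ : Equiv.Perm (Fin n)), i < P.size → (∀ x ∈ K i, σ x = x) →
      rename (fun pq : Fin n × Fin n => (σ pq.1, σ pq.2))
        ((ArithCircuit.gateValues P.gates).getD i 0) =
          (ArithCircuit.gateValues P.gates).getD i 0)
    (hout : ∃ j, P.output = .gate j ∧ j < P.size ∧ K j = ∅) :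
    ∃ (G : Type u) (_ : Fintype G) (C : LabelledArithCircuit F (Fin n × Fin n) Unit G),
      C.IsSymmetric (Equiv.Perm (Fin n)) ∧ C.eval (C.output ()) = P.eval ∧
      Fintype.card G ≤ 3 * (P.size + 1) * (2 * A + 1) * (n + 1) ^ (k + 2) := by
  obtain ⟨j, hPo, hj, hKj⟩ := hout
  let Q : SupportedProgram F n :=
    { gates := P.gates, supp := K, out := j, out_lt := hj, args_ne_nil := hne, refsBelow := hwf.1 }
  have hinv' : ∀ (j : ℕ) (σ : Equiv.Perm (Fin n)), j < Q.gates.length →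
      (∀ x ∈ Q.supp j, σ x = x) → rename (diag σ) (Q.val j) = Q.val j :=
    fun i σ hi hσ => hinv i σ hi hσ
  have hprod' : ∀ i : Fin Q.gates.length, (Q.gate i).isProd = true →
      ∀ t : Fin (arity (Q.gate i)), Q.osuppAt i t ⊆ Q.supp i := by
    intro i hs t
    have key : ∀ (g : ArithCircuit.Gate F (Fin n × Fin n)), P.gates[(i : ℕ)]? = some g →
        g.isProd = true → ∀ t : Fin (arity g), osupp K (operand g t) ⊆ K i := by
      intro g hg hgs t
      cases g with
      | sum _ => simp [ArithCircuit.Gate.isProd] at hgs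
      | prod us => exact hprod i us hg _ (operand_mem_args _ t)
    exact key (Q.gate i) (Q.getElem?_gates i) hs t
  refine ⟨Node Q, inferInstance, Q.circuit, isSymmetric_circuit hKj, ?_, Q.card_node_le hk hA⟩
  rw [eval_output hinv' hprod']
  change (ArithCircuit.gateValues P.gates).getD j 0 =
    P.output.eval (ArithCircuit.gateValues P.gates)
  rw [hPo, ArithCircuit.Operand.eval_gate]

end SupportSymm

end Literature.Computability.AlgebraicComplexity

end
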